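import Summits.ValiantsHypothesis.ValiantsHypothesis.Theses.SymmetroidDescartes
import Summits.ValiantsHypothesis.ValiantsHypothesis.Theorems.SymmetroidDescartesRolleToDescartes
import Literature.Computability.AlgebraicComplexity.RealTauKnownCases

/-!
# `DerivedPencilRolle` — negative lemmas: the scalar base is free, a uniform bordering step is false

Crux `stmt-ValiantsHypothesis-18500` (`Theses.SymmetroidDescartes.DerivedPencilRolle`, route
SymmetroidDescartes): `∃ C a, ∀ m K S d, …, Z₊(det F) ≤ C · Z₊(det ∂F) + (m+K)^a` for `(K+1)`-term
lacunary pencils `F = Σ X^{d l} • S l` with real symmetric invertible `m × m` coefficients.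
`PencilBound C a m` is VERBATIM the crux body at fixed constants and size
(`derivedPencilRolle_iff : DerivedPencilRolle ↔ ∃ C a, ∀ m, PencilBound C a m := Iff.rfl`).
Skeleton-vet findings (refuter, 2026-08-17; two more witness pencils in `Cruxes/DerivedPencilRolle/
SkelVet.lean`). Nothing here asserts a route statement; every theorem is sorry-free.

* §1 THE BASE `m ≤ 1` IS FREE for every pair of constants except `(0,0)`: `pencilBound_zero`
  (`0 × 0`: `det = 1`), `pencilBound_one_of_one_le` (`a ≥ 1`: sparse Descartes, tree lemma
  `card_roots_toFinset_filter_pos_lt_card_support`), `pencilBound_one_of_one_le_C` (`C ≥ 1`: scalar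
  lacunary ROLLE for positive roots, `card_posRoots_le_derivative`, with `f = X^{d₀} g`, `det ∂F = g'`),
  `base_of_constants`; and `(0,0)` really fails: `not_pencilBound_0_0_1` (`(t-1)(t-2)`).
* §2 NINE-ROOT SECULAR WITNESS `S₄`: `diag(g-168, g-288, g-408)`, `g = t³-27t²+194t`, levels
  `(t-1)(t-12)(t-14)`, `(t-2)(t-9)(t-16)`, `(t-4)(t-6)(t-17)`; `∂F = g'·I`: `Z₊(det F) = 9` against
  `2C + 6^a` (`not_pencilBound_3_of`). Hence the crux constants satisfy `2C + 6^a ≥ 9`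
  (`not_instance_of_small_constants`): `a ≥ 2`, or `a = 1 ∧ C ≥ 2`, or `a = 0 ∧ C ≥ 5`.
* §3 A UNIFORM STEP IS FALSE: every reading of "the bound borders up from size `m` to `m+1` with the
  SAME constants, for all constants" fails — unguarded (`not_step_forall_constants`), guarded by
  `1 ≤ m` / `1 ≤ a` / `1 ≤ C` / both / with the base supplied (`not_uniform_step` and variants). For FIXED
  constants the step is trivially implied by the crux instance, so an induction-on-`m` skeleton
  "base (m ≤ 1) + same-constants step" has exactly one open piece, equivalent to the crux.

Sources: Cameron–Psarrakos 2019 (doi:10.7153/oam-2019-13-48) Lemma 1 / Ex. 5; Koiran–Portier–Tavenas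
(arXiv:1205.1015) Lemmas 1–2 (scalar lacunary Rolle). [folklore]
-/

-- `Summit.ValiantsHypothesis.ValiantsHypothesis.…` repeats a component by the D-0017 layout
-- (single-conjunct summit), which the `dupNamespace` linter flags; the name is mandated.
set_option linter.dupNamespace false

namespace Summit.ValiantsHypothesis.ValiantsHypothesis.Theorems.DerivedPencilRolle.Negative

open Summit.ValiantsHypothesis.ValiantsHypothesis.Theses.SymmetroidDescartes
open scoped BigOperators Matrix
open Polynomial

/-! ## §1 The base `m ≤ 1` -/
/-- The crux bound at fixed constants `C a` and fixed size `m` (body copied from the crux). -/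
def PencilBound (C a m : ℕ) : Prop :=
  ∀ (K : ℕ) (S : Fin (K + 1) → Matrix (Fin m) (Fin m) ℝ) (d : Fin (K + 1) → ℕ), (∀ l, (S l).IsSymm) →
    (∀ l, (S l).det ≠ 0) → StrictMono d →
      ((∑ l, (Polynomial.X : Polynomial ℝ) ^ d l • (S l).map Polynomial.C).det.roots.toFinset.filter
          (fun t => 0 < t)).card ≤
        C * ((∑ l : Fin K, (Polynomial.X : Polynomial ℝ) ^ (d l.succ - d 0 - 1) •
          (((d l.succ - d 0 : ℕ) : ℝ) • S l.succ).map Polynomial.C).det.roots.toFinset.filter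
            (fun t => 0 < t)).card + (m + K) ^ a

/-- The crux is literally `∃ C a, ∀ m, PencilBound C a m`. -/
theorem derivedPencilRolle_iff : DerivedPencilRolle ↔ ∃ C a : ℕ, ∀ m, PencilBound C a m := Iff.rfl

/-- Size `m = 0`: the `0 × 0` pencil has determinant `1`, hence no roots; the bound holds for ALL
constants. Consequently a step `∀ C a m, PencilBound C a m → PencilBound C a (m+1)` starting at
`m = 0` asserts `PencilBound C a 1` for every `C a`. -/
theorem pencilBound_zero (C a : ℕ) : PencilBound C a 0 := by
  intro K S d _ _ _
  have h1 : (∑ l, (X : ℝ[X]) ^ d l • (S l).map Polynomial.C).det = 1 := Matrix.det_isEmpty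
  simp [h1]

/-- Size `m = 1`, exponent `a ≥ 1`: the sparse Descartes rule (tree:
`card_roots_toFinset_filter_pos_lt_card_support`) gives `Z₊ ≤ K ≤ (1+K)^a`. -/
theorem pencilBound_one_of_one_le (C a : ℕ) (ha : 1 ≤ a) : PencilBound C a 1 := by
  intro K S d _ hdet hd
  set F : Matrix (Fin 1) (Fin 1) ℝ[X] := ∑ l, (X : ℝ[X]) ^ d l • (S l).map Polynomial.C with hF
  have hdetF : F.det = F 0 0 := Matrix.det_unique F
  have h00 : F 0 0 = ∑ l, Polynomial.C (S l 0 0) * (X : ℝ[X]) ^ d l := by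
    simp only [hF, Matrix.sum_apply, Matrix.smul_apply, Matrix.map_apply, smul_eq_mul]
    exact Finset.sum_congr rfl fun l _ => mul_comm _ _
  have hne : F 0 0 ≠ 0 := by
    intro h0
    have hc := congrArg (fun p : ℝ[X] => p.coeff (d 0)) h0
    simp only [h00, finsetSum_coeff, coeff_C_mul_X_pow, coeff_zero] at hc
    rw [Finset.sum_eq_single (0 : Fin (K + 1))] at hc
    · simp only [if_true] at hc
      exact hdet 0 (by rw [Matrix.det_unique]; exact hc)
    · intro l _ hl
      rw [if_neg]
      exact fun h => hl (hd.injective h).symm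
    · simp
  have hsupp : (F 0 0).support.card ≤ K + 1 := by
    rw [h00]
    calc (∑ l, Polynomial.C (S l 0 0) * (X : ℝ[X]) ^ d l).support.card
        ≤ ∑ l, (Polynomial.C (S l 0 0) * (X : ℝ[X]) ^ d l).support.card :=
          Literature.Computability.AlgebraicComplexity.card_support_sum_le _ _
      _ ≤ ∑ _l : Fin (K + 1), 1 := Finset.sum_le_sum fun l _ => card_support_C_mul_X_pow_le_one
      _ = K + 1 := by simp
  have hdesc := Literature.Computability.AlgebraicComplexity.card_roots_toFinset_filter_pos_lt_card_support hne
  have hpow : K + 1 ≤ (1 + K) ^ a := by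
    calc K + 1 = (1 + K) ^ 1 := by ring
      _ ≤ (1 + K) ^ a := Nat.pow_le_pow_right (by omega) ha
  rw [hdetF]
  have : ((F 0 0).roots.toFinset.filter (fun t => 0 < t)).card ≤ K := by omega
  calc ((F 0 0).roots.toFinset.filter (fun t => 0 < t)).card ≤ K := this
    _ ≤ C * _ + (1 + K) ^ a := by omega


/-- **Rolle for positive roots.** A real polynomial has at most one more distinct positive root than
its derivative. -/
theorem card_posRoots_le_derivative (g : ℝ[X]) :
    (g.roots.toFinset.filter (fun t => 0 < t)).card ≤
      (g.derivative.roots.toFinset.filter (fun t => 0 < t)).card + 1 := by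
  rcases eq_or_ne (derivative g) 0 with hg' | hg'
  · rw [eq_C_of_derivative_eq_zero hg', roots_C, Multiset.toFinset_zero, Finset.filter_empty,
      Finset.card_empty]
    exact Nat.zero_le _
  have hg : g ≠ 0 := ne_of_apply_ne derivative (by rwa [derivative_zero])
  calc (g.roots.toFinset.filter (fun t => 0 < t)).card
      ≤ ((g.derivative.roots.toFinset.filter (fun t => 0 < t)) \
            g.roots.toFinset.filter (fun t => 0 < t)).card + 1 := by
        refine Finset.card_le_sdiff_of_interleaved fun x hx y hy hxy _ => ?_
        rw [Finset.mem_filter, Multiset.mem_toFinset, mem_roots hg] at hx hy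
        obtain ⟨z, hz1, hz2⟩ :=
          exists_deriv_eq_zero (f := fun u => g.eval u) hxy g.continuousOn (by
            rw [hx.1.eq_zero, hy.1.eq_zero])
        refine ⟨z, ?_, hz1.1, hz1.2⟩
        rw [Finset.mem_filter, Multiset.mem_toFinset, mem_roots hg', IsRoot, ← g.deriv]
        exact ⟨hz2, hx.2.trans hz1.1⟩
    _ ≤ (g.derivative.roots.toFinset.filter (fun t => 0 < t)).card + 1 := by
        gcongr
        exact Finset.sdiff_subset

/-- Size `m = 1`, multiplier `C ≥ 1`: scalar lacunary Rolle. Writing `f = t^{d₀} g`, the positive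
roots of `f = det F` are those of `g`, and the derived pencil's determinant is `g'`. -/
theorem pencilBound_one_of_one_le_C (C a : ℕ) (hC : 1 ≤ C) : PencilBound C a 1 := by
  intro K S d _ hdet hd
  -- the two 1×1 determinants
  rw [Matrix.det_unique, Matrix.det_unique]
  simp only [Fin.default_eq_zero]
  set s : Fin (K + 1) → ℝ := fun l => S l 0 0 with hs
  have hs0 : ∀ l, s l ≠ 0 := fun l h => hdet l (by rw [Matrix.det_unique]; exact h)
  have hmono : ∀ l, d 0 ≤ d l := fun l => hd.monotone (Fin.zero_le l)
  -- f and the derived entry, in closed form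
  have hf : (∑ l, (X : ℝ[X]) ^ d l • (S l).map Polynomial.C) 0 0 =
      ∑ l, Polynomial.C (s l) * X ^ d l := by
    simp only [Matrix.sum_apply, Matrix.smul_apply, Matrix.map_apply, smul_eq_mul, hs]
    exact Finset.sum_congr rfl fun l _ => mul_comm _ _
  have hG : (∑ l : Fin K, (X : ℝ[X]) ^ (d l.succ - d 0 - 1) •
      ((((d l.succ - d 0 : ℕ) : ℝ)) • S l.succ).map Polynomial.C) 0 0 =
      ∑ l : Fin K, Polynomial.C (s l.succ * ((d l.succ - d 0 : ℕ) : ℝ)) * X ^ (d l.succ - d 0 - 1) := by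
    simp only [Matrix.sum_apply, Matrix.smul_apply, Matrix.map_apply, smul_eq_mul, hs]
    exact Finset.sum_congr rfl fun l _ => by rw [mul_comm (X ^ _), mul_comm (s _)]
  -- g := f / t^{d₀}
  set g : ℝ[X] := ∑ l, Polynomial.C (s l) * X ^ (d l - d 0) with hg
  have hfg : (∑ l, Polynomial.C (s l) * X ^ d l) = X ^ d 0 * g := by
    rw [hg, Finset.mul_sum]
    refine Finset.sum_congr rfl fun l _ => ?_
    rw [mul_left_comm, ← pow_add, Nat.add_sub_cancel' (hmono l)]
  have hg' : derivative g =
      ∑ l : Fin K, Polynomial.C (s l.succ * ((d l.succ - d 0 : ℕ) : ℝ)) * X ^ (d l.succ - d 0 - 1) := by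
    rw [hg, derivative_sum, Fin.sum_univ_succ]
    simp only [derivative_C_mul_X_pow, Nat.sub_self, Nat.cast_zero, mul_zero, map_zero, zero_mul,
      zero_add]
  -- g ≠ 0 : its constant coefficient is s 0
  have hg0 : g ≠ 0 := by
    intro h0
    have hc := congrArg (fun p : ℝ[X] => p.coeff 0) h0
    simp only [hg, finsetSum_coeff, coeff_C_mul_X_pow, coeff_zero] at hc
    rw [Finset.sum_eq_single (0 : Fin (K + 1))] at hc
    · simp only [Nat.sub_self, if_true] at hc
      exact hs0 0 hc
    · intro l _ hl
      rw [if_neg]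
      intro h
      have : d l ≤ d 0 := Nat.le_of_sub_eq_zero h.symm
      exact hl (le_antisymm (hd.le_iff_le.mp this) (Fin.zero_le l))
    · simp
  have hf0 : X ^ d 0 * g ≠ 0 := mul_ne_zero (pow_ne_zero _ X_ne_zero) hg0
  -- positive roots of f = positive roots of g
  have hroots : ((X ^ d 0 * g).roots.toFinset.filter (fun t => 0 < t)) =
      (g.roots.toFinset.filter (fun t => 0 < t)) := by
    ext t
    simp only [Finset.mem_filter, Multiset.mem_toFinset, mem_roots hf0, mem_roots hg0, IsRoot.def,
      eval_mul, eval_pow, eval_X, mul_eq_zero, pow_eq_zero_iff', ne_eq]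
    constructor
    · rintro ⟨h | h, ht⟩
      · exact absurd h.1 ht.ne'
      · exact ⟨h, ht⟩
    · rintro ⟨h, ht⟩
      exact ⟨Or.inr h, ht⟩
  rw [hf, hG, hfg, hroots, ← hg']
  have hR := card_posRoots_le_derivative g
  have h1 : 1 ≤ (1 + K) ^ a := Nat.one_le_pow _ _ (by omega)
  have h2 : (g.derivative.roots.toFinset.filter (fun t => 0 < t)).card ≤
      C * (g.derivative.roots.toFinset.filter (fun t => 0 < t)).card :=
    Nat.le_mul_of_pos_left _ hC
  omega

/-! ## §1b `(0,0)` is excluded -/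
/-- The scalar 3-nomial `2 - 3t + t² = (t-1)(t-2)`: coefficients as `1 × 1` matrices. -/
def S₁ : Fin 3 → Matrix (Fin 1) (Fin 1) ℝ := ![!![2], !![-3], !![1]]

/-- The coefficients of `S₁` are invertible. -/
theorem S₁_det (l : Fin 3) : (S₁ l).det ≠ 0 := by
  fin_cases l <;> simp [S₁, Matrix.det_unique]

/-- The coefficients of `S₁` are symmetric. -/
theorem S₁_symm (l : Fin 3) : (S₁ l).IsSymm := by
  fin_cases l <;> (unfold Matrix.IsSymm; ext i j; fin_cases i; fin_cases j; rfl)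

/-- The pencil polynomial of the witness. -/
theorem S₁_det_pencil :
    (∑ l : Fin 3, (X : ℝ[X]) ^ ((l : ℕ)) • (S₁ l).map Polynomial.C).det =
      Polynomial.C 2 + Polynomial.C (-3) * X + Polynomial.C 1 * X ^ 2 := by
  rw [Matrix.det_unique]
  simp [S₁, Matrix.sum_apply, Fin.sum_univ_three, Matrix.smul_apply, smul_eq_mul]

/-- `m = 1`, `C = 0`, `a = 0` fails: `(t-1)(t-2)` has two positive roots but the bound allows one. -/
theorem not_pencilBound_0_0_1 : ¬ PencilBound 0 0 1 := by
  intro h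
  have hb := h 2 S₁ (fun l => (l : ℕ)) S₁_symm S₁_det Fin.val_strictMono
  rw [S₁_det_pencil] at hb
  simp only [zero_mul, zero_add, pow_zero] at hb
  set p : ℝ[X] := Polynomial.C 2 + Polynomial.C (-3) * X + Polynomial.C 1 * X ^ 2 with hp
  have hp0 : p ≠ 0 := by
    intro h0
    have := congrArg (Polynomial.eval 0) h0
    simp [hp] at this
  have hmem : ∀ r : ℝ, p.eval r = 0 → 0 < r → r ∈ p.roots.toFinset.filter (fun t => 0 < t) := by
    intro r hr hpos
    simp only [Finset.mem_filter, Multiset.mem_toFinset, Polynomial.mem_roots hp0, Polynomial.IsRoot.def]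
    exact ⟨hr, hpos⟩
  have h1 : (1 : ℝ) ∈ p.roots.toFinset.filter (fun t => 0 < t) := hmem 1 (by simp [hp]; norm_num) one_pos
  have h2 : (2 : ℝ) ∈ p.roots.toFinset.filter (fun t => 0 < t) := hmem 2 (by simp [hp]; norm_num) two_pos
  have hcard : 2 ≤ (p.roots.toFinset.filter (fun t => 0 < t)).card := by
    have hsub : ({1, 2} : Finset ℝ) ⊆ p.roots.toFinset.filter (fun t => 0 < t) := by
      intro x hx
      simp only [Finset.mem_insert, Finset.mem_singleton] at hx
      rcases hx with rfl | rfl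
      · exact h1
      · exact h2
    have h12 : ({1, 2} : Finset ℝ).card = 2 := by
      rw [Finset.card_insert_of_notMem (by norm_num), Finset.card_singleton]
    exact h12 ▸ Finset.card_le_card hsub
  omega


/-! ## §2 The nine-root secular witness -/
/-- Commuting ("secular") `3 × 3` four-nomial witness with SCALAR higher coefficients:
`F(t) = diag(-168,-288,-408) + t • 194 I - t² • 27 I + t³ • I`, i.e. `diag(g - 168, g - 288, g - 408)` with
`g = t³ - 27t² + 194t`; the three levels factor as `(t-1)(t-12)(t-14)`, `(t-2)(t-9)(t-16)`,
`(t-4)(t-6)(t-17)` (equal `e₁ = 27`, `e₂ = 194`), so `det F` has NINE positive roots, while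
`∂F = g' I`, `det ∂F = (3t² - 54t + 194)³` has at most two. -/
noncomputable def S₄ : Fin 4 → Matrix (Fin 3) (Fin 3) ℝ :=
  ![!![-168, 0, 0; 0, -288, 0; 0, 0, -408], !![194, 0, 0; 0, 194, 0; 0, 0, 194],
    !![-27, 0, 0; 0, -27, 0; 0, 0, -27], !![1, 0, 0; 0, 1, 0; 0, 0, 1]]

/-- The coefficients of `S₄` are invertible. -/
theorem S₄_det (l : Fin 4) : (S₄ l).det ≠ 0 := by
  fin_cases l <;> simp [S₄, Matrix.det_fin_three]

/-- The coefficients of `S₄` are symmetric (diagonal). -/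
theorem S₄_symm (l : Fin 4) : (S₄ l).IsSymm := by
  fin_cases l <;> (unfold Matrix.IsSymm; ext i j; fin_cases i <;> fin_cases j <;> rfl)

/-- The level cubic `g - μ = -μ + 194 t - 27 t² + t³`. -/
noncomputable def g₄ (μ : ℝ) : ℝ[X] :=
  Polynomial.C (-μ) + Polynomial.C 194 * X + Polynomial.C (-27) * X ^ 2 + Polynomial.C 1 * X ^ 3
/-- the diagonal entry of the derived pencil, `g'` -/
noncomputable def r₄ : ℝ[X] := Polynomial.C 194 + Polynomial.C (-54) * X + Polynomial.C 3 * X ^ 2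

/-- `det F = (g-168)(g-288)(g-408)` for the pencil of `S₄` with exponents `0,1,2,3`. -/
theorem S₄_det_pencil :
    (∑ l : Fin 4, (X : ℝ[X]) ^ ((l : ℕ)) • (S₄ l).map Polynomial.C).det = g₄ 168 * g₄ 288 * g₄ 408 := by
  rw [Matrix.det_fin_three]
  simp [S₄, g₄, Matrix.sum_apply, Fin.sum_univ_four, Matrix.smul_apply, smul_eq_mul]

/-- The derived pencil of `S₄` has determinant `g'³`. -/
theorem S₄_det_derived :
    (∑ l : Fin 3, (X : ℝ[X]) ^ (((l.succ : Fin 4) : ℕ) - ((0 : Fin 4) : ℕ) - 1) •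
      (((((l.succ : Fin 4) : ℕ) - ((0 : Fin 4) : ℕ) : ℕ) : ℝ) • S₄ l.succ).map Polynomial.C).det
      = r₄ * r₄ * r₄ := by
  rw [Matrix.det_fin_three]
  simp [S₄, r₄, Matrix.sum_apply, Fin.sum_univ_three, Matrix.smul_apply, smul_eq_mul, map_ofNat]
  norm_num [map_ofNat]
  ring

/-- The level cubics are nonzero. -/
theorem g₄_ne_zero (μ : ℝ) (hμ : μ ≠ 0) : g₄ μ ≠ 0 := by
  intro h0
  have := congrArg (Polynomial.eval 0) h0
  norm_num [g₄] at this
  exact hμ this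

/-- `det F ≠ 0` for the `S₄` pencil. -/
theorem ggg_ne_zero : g₄ 168 * g₄ 288 * g₄ 408 ≠ 0 :=
  mul_ne_zero (mul_ne_zero (g₄_ne_zero _ (by norm_num)) (g₄_ne_zero _ (by norm_num)))
    (g₄_ne_zero _ (by norm_num))

/-- `g' ≠ 0`. -/
theorem r₄_ne_zero : r₄ ≠ 0 := by
  intro h0
  have := congrArg (Polynomial.eval 0) h0
  norm_num [r₄] at this

/-- `det F` factors with roots `1,12,14, 2,9,16, 4,6,17`. -/
theorem eval_ggg (t : ℝ) : (g₄ 168 * g₄ 288 * g₄ 408).eval t =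
    ((t - 1) * (t - 12) * (t - 14)) * ((t - 2) * (t - 9) * (t - 16)) * ((t - 4) * (t - 6) * (t - 17)) := by
  simp [g₄]
  ring

/-- `g'³` has at most two distinct positive roots (`deg g' = 2`). -/
theorem card_posRoots_rrr_le_two : ((r₄ * r₄ * r₄).roots.toFinset.filter (fun t => 0 < t)).card ≤ 2 := by
  have hdeg : r₄.natDegree ≤ 2 := by
    unfold r₄
    compute_degree!
  have hrr : r₄ * r₄ ≠ 0 := mul_ne_zero r₄_ne_zero r₄_ne_zero
  calc ((r₄ * r₄ * r₄).roots.toFinset.filter (fun t => 0 < t)).card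
      ≤ (r₄ * r₄ * r₄).roots.toFinset.card := Finset.card_filter_le _ _
    _ = r₄.roots.toFinset.card := by
        rw [roots_mul (mul_ne_zero hrr r₄_ne_zero), roots_mul hrr, Multiset.toFinset_add,
          Multiset.toFinset_add, Finset.union_idempotent, Finset.union_idempotent]
    _ ≤ Multiset.card r₄.roots := Multiset.toFinset_card_le _
    _ ≤ r₄.natDegree := card_roots' _
    _ ≤ 2 := hdeg

/-- `m = 3`, `K = 3`: nine positive roots against the allowance `2C + 6^a`; false whenever
`2C + 6^a < 9`, i.e. for `(C,a) ∈ {(0,0),(1,0),(2,0),(3,0),(4,0),(0,1),(1,1)}`. -/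
theorem not_pencilBound_3_of (C a : ℕ) (hCa : 2 * C + 6 ^ a < 9) : ¬ PencilBound C a 3 := by
  intro h
  have hb := h 3 S₄ (fun l => (l : ℕ)) S₄_symm S₄_det Fin.val_strictMono
  rw [S₄_det_pencil, S₄_det_derived] at hb
  have hmem : ∀ t : ℝ, (g₄ 168 * g₄ 288 * g₄ 408).eval t = 0 → 0 < t →
      t ∈ (g₄ 168 * g₄ 288 * g₄ 408).roots.toFinset.filter (fun t => 0 < t) := by
    intro t ht hpos
    simp only [Finset.mem_filter, Multiset.mem_toFinset, Polynomial.mem_roots ggg_ne_zero,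
      Polynomial.IsRoot.def]
    exact ⟨ht, hpos⟩
  have hsub : ({1, 12, 14, 2, 9, 16, 4, 6, 17} : Finset ℝ) ⊆
      (g₄ 168 * g₄ 288 * g₄ 408).roots.toFinset.filter (fun t => 0 < t) := by
    intro x hx
    simp only [Finset.mem_insert, Finset.mem_singleton] at hx
    rcases hx with rfl | rfl | rfl | rfl | rfl | rfl | rfl | rfl | rfl <;>
      exact hmem _ (by rw [eval_ggg]; norm_num) (by norm_num)
  have h9 : ({1, 12, 14, 2, 9, 16, 4, 6, 17} : Finset ℝ).card = 9 := by
    rw [Finset.card_insert_of_notMem (by norm_num), Finset.card_insert_of_notMem (by norm_num),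
      Finset.card_insert_of_notMem (by norm_num), Finset.card_insert_of_notMem (by norm_num),
      Finset.card_insert_of_notMem (by norm_num), Finset.card_insert_of_notMem (by norm_num),
      Finset.card_insert_of_notMem (by norm_num), Finset.card_insert_of_notMem (by norm_num),
      Finset.card_singleton]
  have hcard := Finset.card_le_card hsub
  rw [h9] at hcard
  have hr := card_posRoots_rrr_le_two
  have hmul : C * ((r₄ * r₄ * r₄).roots.toFinset.filter (fun t => 0 < t)).card ≤ C * 2 :=
    Nat.mul_le_mul_left C hr
  have h6 : (3 + 3) ^ a = 6 ^ a := by norm_num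
  rw [h6] at hb
  omega


/-! ## §3 Consequences: constants of the crux, and no uniform bordering step -/

/-- The scalar base in full: `m = 1` holds for every pair of constants except `(0,0)`. -/
theorem pencilBound_one (C a : ℕ) (h : 1 ≤ C ∨ 1 ≤ a) : PencilBound C a 1 :=
  h.elim (pencilBound_one_of_one_le_C C a) (pencilBound_one_of_one_le C a)

/-- The base (`m ≤ 1`) for every non-degenerate pair of constants. -/
theorem base_of_constants (C a : ℕ) (h : 1 ≤ C ∨ 1 ≤ a) : ∀ m ≤ 1, PencilBound C a m := by
  intro m hm
  interval_cases m
  · exact pencilBound_zero C a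
  · exact pencilBound_one C a h

/-- Constants the crux cannot have: `2C + 6^a < 9`. -/
theorem not_instance_of_small_constants (C a : ℕ) (h : 2 * C + 6 ^ a < 9) :
    ¬ ∀ m, PencilBound C a m := fun hall => not_pencilBound_3_of C a h (hall 3)

/-- Unguarded "same constants" step: false — from the free size `0` three applications at the
degenerate constants `(0,0)` would give `PencilBound 0 0 3`. -/
theorem not_step_forall_constants :
    ¬ ∀ C a m : ℕ, PencilBound C a m → PencilBound C a (m + 1) := fun h =>
  not_pencilBound_3_of 0 0 (by norm_num)
    (h 0 0 2 (h 0 0 1 (h 0 0 0 (pencilBound_zero 0 0))))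

/-- Step for all constants with `1 ≤ C`, `1 ≤ a`, bordering only from `m ≥ 1`: false at `(1,1)` —
the base holds and two applications would give `PencilBound 1 1 3`. -/
theorem not_step_forall_posC_posA :
    ¬ ∀ C a m : ℕ, 1 ≤ C → 1 ≤ a → 1 ≤ m → PencilBound C a m → PencilBound C a (m + 1) := fun h =>
  not_pencilBound_3_of 1 1 (by norm_num)
    (h 1 1 2 le_rfl le_rfl (by norm_num)
      (h 1 1 1 le_rfl le_rfl le_rfl (pencilBound_one 1 1 (Or.inl le_rfl))))

/-- OMNIBUS: no bordering step uniform in the constants — non-degenerate constants, base supplied,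
bordering only from `m ≥ 1`. Any stub of the shape "for all constants, the bound at size `m` implies
the bound at size `m + 1` with the same constants" is unprovable, whatever the guards. -/
theorem not_uniform_step :
    ¬ ∀ C a : ℕ, (1 ≤ C ∨ 1 ≤ a) → (∀ m ≤ 1, PencilBound C a m) →
      ∀ m, 1 ≤ m → PencilBound C a m → PencilBound C a (m + 1) := fun h =>
  have hb : ∀ m ≤ 1, PencilBound 1 1 m := base_of_constants 1 1 (Or.inl le_rfl)
  not_pencilBound_3_of 1 1 (by norm_num)
    (h 1 1 (Or.inl le_rfl) hb 2 (by norm_num) (h 1 1 (Or.inl le_rfl) hb 1 le_rfl (hb 1 le_rfl)))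

end Summit.ValiantsHypothesis.ValiantsHypothesis.Theorems.DerivedPencilRolle.Negative
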